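import Mathlib.Analysis.Calculus.MeanValue
import Mathlib.Analysis.Calculus.Deriv.MeanValue

/-!
# BalabanUVNodes ∕ node N14 = NE1′ — LENS control CARD 11, THE N14-LANE REMAINDER (III-a): A MONOTONE IMPLICIT-FUNCTION LEMMA ON A STRIP
# (the pure real-analysis half of K11c′ «existence of the tuned counterterm path»)

Cell `pub-ymgap`, HUMAN RULING D-0062 (Track A at full width), seat `pub-ymgap-dag-n14-c` (R134 ACCELERATION, strategy s1), generation 7 (idle re-seat);
route `Summits/QuantumFields/YangMills/Theses/BalabanUVNodes.lean` rev 18∕19 (cluster K3⁗ `SpineGivenEndpointR13Sep` = stmt-QuantumFields-20292,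
`--kind proof --supports … --as helper`); venue ruling R424 (`YangMills/Theorems`, namespace `YMDAG.N14.LawChannelTunedPath`).  ADDITIVE — imports Mathlib's mean
value inequalities only; THEOREMS ONLY (0 `def`), modifies nothing.  Companion (III-b) `…N14LawChannelTunedPath` instantiates the lemma on the countertermed chord
of LENS control CARD 11 and proves K11c′ `exists_tuned_path` (signature of `ym-lens-BalabanUVNodes-control/Sketch-control-g7.lean` d9b91efbe9c6728d §3, credited).

WHY A HAND-ROLLED LEMMA.  K11c′ asks for a C¹ counterterm `κ : ℝ → ℝ` with `κ 0 = κ 1 = 0` holding a renormalisation observable fixed along `u ∈ [0,1]`, from a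
uniformly positive response on the strip `[0,1] × [-V, V]` and a bracket at `v = ±V`.  This is a ONE-dimensional implicit-function statement with a MONOTONE section
map; it needs neither inverse-function machinery nor strict differentiability: the zero is produced pointwise by the intermediate value theorem, its uniqueness and the
Lipschitz continuity of the zero curve by the uniform growth in `v`, its derivative by an `ε`-argument from ONE-dimensional partial derivatives and the joint continuity
of `∂_v G`, and the global C¹ function by an affine extension off `[0,1]` (one-sided derivatives glued with `HasDerivWithinAt.union`).

WHAT THIS IS.
* §1 [folklore] `mul_sub_le_sub_of_resp` (growth `γ·(v₂ − v₁) ≤ G(u,v₂) − G(u,v₁)` on the window from `∂_v G ≥ γ`; Mathlib `Convex.mul_sub_le_image_sub_of_le_deriv`),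
  `zero_unique_of_resp`, `mul_abs_sub_le_abs_sub_of_resp`, `exists_zero_mem_Icc` (IVT from the bracket), ★ `hasDerivWithinAt_of_implicit` — THE DERIVATIVE OF AN
  IMPLICIT ZERO CURVE: `G(u′, κ u′) = 0` on `s ∋ u`, `κ` Lipschitz at `u` along `s`, `t ↦ G(t, κ u)` differentiable at `u`, `v`-sections differentiable with `∂_v G`
  jointly continuous and non-zero at `(u, κ u)` ⇒ `HasDerivWithinAt κ (−∂_uG ∕ ∂_vG) s u`.
* §2 [folklore] `exists_C1_extension` — a function with continuous derivative WITHIN `[0,1]` extends (affinely) to a C¹ function on `ℝ`.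
* §3 [folklore] ★★ `exists_C1_zeroCurve` — THE MONOTONE IMPLICIT-FUNCTION LEMMA ON THE STRIP: `∂_u G`, `∂_v G` everywhere and jointly continuous, `∂_v G ≥ γ > 0`
  on `[0,1] × [-V,V]`, bracket `G(u,-V) ≤ 0 ≤ G(u,V)`, `G(0,0) = G(1,0) = 0` ⇒ ∃ C¹ `κ` on `ℝ`, `κ 0 = κ 1 = 0`, `κ([0,1]) ⊆ [-V,V]`, `G(u, κ u) = 0` on `[0,1]`.

WHAT THIS IS NOT.  Pure real analysis on hypothesis shapes (0 `sorry`, 0 named facts); nothing of Bałaban's; N14 ∕ N19 NOT discharged; count-neutral.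
One finite four-torus programme at fixed ε; NOT ℝ⁴, NOT OS, NOT a mass gap, NOT Clay.
-/

set_option autoImplicit false

noncomputable section

namespace YMDAG.N14.LawChannelTunedPath

open Set Filter Topology

/-! ## §1 A uniformly increasing family `v ↦ G u v` on the window `[-V, V]`: growth, the unique zero, and the derivative of the zero curve -/
section ZeroCurve

variable {G Gu Gv : ℝ → ℝ → ℝ} {γ V : ℝ}

/-- **GROWTH ON THE WINDOW**: if `∂_v G(u,·) ≥ γ` on `[-V, V]` then `γ·(v₂ − v₁) ≤ G(u,v₂) − G(u,v₁)` for `-V ≤ v₁ ≤ v₂ ≤ V`. [folklore; Mathlib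
`Convex.mul_sub_le_image_sub_of_le_deriv`] -/
theorem mul_sub_le_sub_of_resp (hGv : ∀ u v, HasDerivAt (fun t => G u t) (Gv u v) v) {u : ℝ}
    (hresp : ∀ v ∈ Icc (-V) V, γ ≤ Gv u v) {v₁ v₂ : ℝ} (hv₁ : v₁ ∈ Icc (-V) V) (hv₂ : v₂ ∈ Icc (-V) V) (h : v₁ ≤ v₂) :
    γ * (v₂ - v₁) ≤ G u v₂ - G u v₁ := by
  have hcont : ContinuousOn (fun t => G u t) (Icc (-V) V) := fun t _ => (hGv u t).continuousAt.continuousWithinAt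
  have hdiff : DifferentiableOn ℝ (fun t => G u t) (interior (Icc (-V) V)) := fun t _ =>
    (hGv u t).differentiableAt.differentiableWithinAt
  refine (convex_Icc (-V) V).mul_sub_le_image_sub_of_le_deriv hcont hdiff (fun t ht => ?_) v₁ hv₁ v₂ hv₂ h
  rw [(hGv u t).deriv]
  rw [interior_Icc] at ht
  exact hresp t (Ioo_subset_Icc_self ht)

/-- **THE ZERO IS UNIQUE IN THE WINDOW** (`γ > 0`). [folklore] -/
theorem zero_unique_of_resp (hγ : 0 < γ) (hGv : ∀ u v, HasDerivAt (fun t => G u t) (Gv u v) v) {u : ℝ}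
    (hresp : ∀ v ∈ Icc (-V) V, γ ≤ Gv u v) {v₁ v₂ : ℝ} (hv₁ : v₁ ∈ Icc (-V) V) (hv₂ : v₂ ∈ Icc (-V) V)
    (h₁ : G u v₁ = 0) (h₂ : G u v₂ = 0) : v₁ = v₂ := by
  rcases le_total v₁ v₂ with h | h
  · have := mul_sub_le_sub_of_resp hGv hresp hv₁ hv₂ h
    rw [h₁, h₂, sub_self] at this
    nlinarith
  · have := mul_sub_le_sub_of_resp hGv hresp hv₂ hv₁ h
    rw [h₁, h₂, sub_self] at this
    nlinarith

/-- **THE ABSOLUTE GROWTH**: `γ·|v₂ − v₁| ≤ |G(u,v₂) − G(u,v₁)|` on the window. [folklore] -/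
theorem mul_abs_sub_le_abs_sub_of_resp (hGv : ∀ u v, HasDerivAt (fun t => G u t) (Gv u v) v) {u : ℝ}
    (hresp : ∀ v ∈ Icc (-V) V, γ ≤ Gv u v) {v₁ v₂ : ℝ} (hv₁ : v₁ ∈ Icc (-V) V) (hv₂ : v₂ ∈ Icc (-V) V) :
    γ * |v₂ - v₁| ≤ |G u v₂ - G u v₁| := by
  rcases le_total v₁ v₂ with h | h
  · have := mul_sub_le_sub_of_resp hGv hresp hv₁ hv₂ h
    rw [abs_of_nonneg (sub_nonneg.2 h)]
    exact this.trans (le_abs_self _)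
  · have := mul_sub_le_sub_of_resp hGv hresp hv₂ hv₁ h
    rw [abs_sub_comm v₂ v₁, abs_sub_comm (G u v₂) (G u v₁), abs_of_nonneg (sub_nonneg.2 h)]
    exact this.trans (le_abs_self _)

/-- **EXISTENCE OF THE ZERO** from the bracket `G(u,-V) ≤ 0 ≤ G(u,V)` (intermediate value theorem). [folklore] -/
theorem exists_zero_mem_Icc (hV : 0 ≤ V) (hGv : ∀ u v, HasDerivAt (fun t => G u t) (Gv u v) v) {u : ℝ}
    (hbr : G u (-V) ≤ 0 ∧ 0 ≤ G u V) : ∃ v ∈ Icc (-V) V, G u v = 0 := by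
  have hcont : ContinuousOn (fun t => G u t) (Icc (-V) V) := fun t _ => (hGv u t).continuousAt.continuousWithinAt
  have hmem : (0 : ℝ) ∈ Icc (G u (-V)) (G u V) := ⟨hbr.1, hbr.2⟩
  exact intermediate_value_Icc (by linarith) hcont hmem

/-- **THE DERIVATIVE OF AN IMPLICIT ZERO CURVE** (one-variable, no inverse-function machinery): if `G(u′, κ u′) = 0` on `s ∋ u`, `κ` is Lipschitz AT `u`
along `s`, `t ↦ G(t, κ u)` is differentiable at `u`, every `v`-section is differentiable with `∂_v G` jointly continuous at `(u, κ u)` and non-zero there, then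
`κ` is differentiable at `u` within `s` with the implicit-function value `−∂_u G ∕ ∂_v G`.  Proof: `0 = [G(u′,κu′) − G(u′,κu)] + [G(u′,κu) − G(u,κu)]`; the second
bracket is `(u′−u)·∂_uG + o(u′−u)`; the first is `(κu′−κu)·∂_vG + o(κu′−κu)` by the mean value inequality applied to `t ↦ G(u′,t) − t·∂_vG(u,κu)` on the segment,
whose derivative is small by joint continuity; Lipschitz turns `o(κu′−κu)` into `o(u′−u)`. [folklore] -/
theorem hasDerivWithinAt_of_implicit {κ : ℝ → ℝ} {s : Set ℝ} {u C : ℝ}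
    (hGu : HasDerivAt (fun t => G t (κ u)) (Gu u (κ u)) u)
    (hGv : ∀ u' v, HasDerivAt (fun t => G u' t) (Gv u' v) v)
    (hGv_c : ContinuousAt (Function.uncurry Gv) (u, κ u))
    (hb : Gv u (κ u) ≠ 0) (hu : u ∈ s) (hzero : ∀ u' ∈ s, G u' (κ u') = 0)
    (hC : 0 ≤ C) (hlip : ∀ u' ∈ s, |κ u' - κ u| ≤ C * |u' - u|) :
    HasDerivWithinAt κ (-(Gu u (κ u)) / Gv u (κ u)) s u := by
  set v₀ : ℝ := κ u with hv₀
  set a : ℝ := Gu u v₀ with ha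
  set b : ℝ := Gv u v₀ with hbdef
  rw [hasDerivWithinAt_iff_isLittleO, Asymptotics.isLittleO_iff]
  intro c hc
  have hb0 : 0 < |b| := abs_pos.2 hb
  set ε₁ : ℝ := c * |b| / 2 with hε₁def
  set ε₂ : ℝ := c * |b| / (2 * (C + 1)) with hε₂def
  have hC1 : 0 < C + 1 := by linarith
  have hε₁ : 0 < ε₁ := by positivity
  have hε₂ : 0 < ε₂ := by positivity
  -- (1) the `u`-partial at the point
  have h1 : ∀ᶠ u' in 𝓝[s] u, |G u' v₀ - G u v₀ - (u' - u) * a| ≤ ε₁ * |u' - u| := by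
    have h := (hGu.hasDerivWithinAt (s := s)).isLittleO
    rw [Asymptotics.isLittleO_iff] at h
    filter_upwards [h hε₁] with u' hu'
    simpa only [Real.norm_eq_abs, smul_eq_mul] using hu'
  -- (2) joint continuity of `∂_v G` at `(u, v₀)`
  obtain ⟨δ, hδ, hδ'⟩ := Metric.continuousAt_iff.1 hGv_c ε₂ hε₂
  -- (3) localise
  have h3 : ∀ᶠ u' in 𝓝[s] u, |u' - u| < δ / (C + 1) ∧ u' ∈ s := by
    have hball : Metric.ball u (δ / (C + 1)) ∈ 𝓝 u := Metric.ball_mem_nhds u (by positivity)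
    filter_upwards [mem_nhdsWithin_of_mem_nhds hball, self_mem_nhdsWithin] with u' h h'
    exact ⟨by rwa [Metric.mem_ball, Real.dist_eq] at h, h'⟩
  filter_upwards [h1, h3] with u' hA hu'
  obtain ⟨hd, hu's⟩ := hu'
  have hlipu : |κ u' - v₀| ≤ C * |u' - u| := hlip u' hu's
  -- the `v`-derivative is within `ε₂` of `b` on the segment between `v₀` and `κ u'`
  have hseg : ∀ t ∈ uIcc v₀ (κ u'), |Gv u' t - b| ≤ ε₂ := by
    intro t ht
    have ht' : |t - v₀| ≤ |κ u' - v₀| := abs_sub_left_of_mem_uIcc ht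
    have hdist : dist (u', t) (u, v₀) < δ := by
      rw [Prod.dist_eq, Real.dist_eq, Real.dist_eq, max_lt_iff]
      constructor
      · calc |u' - u| < δ / (C + 1) := hd
          _ ≤ δ := div_le_self hδ.le (by linarith)
      · calc |t - v₀| ≤ C * |u' - u| := ht'.trans hlipu
          _ ≤ C * (δ / (C + 1)) := mul_le_mul_of_nonneg_left hd.le hC
          _ = δ * (C / (C + 1)) := by ring
          _ < δ := by
              have : C / (C + 1) < 1 := (div_lt_one hC1).2 (by linarith)
              nlinarith
    have h := hδ' hdist
    rw [Real.dist_eq] at h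
    exact h.le
  -- the mean value inequality for `t ↦ G u' t − t·b` on the segment
  have hB : |G u' (κ u') - G u' v₀ - (κ u' - v₀) * b| ≤ ε₂ * |κ u' - v₀| := by
    have key := Convex.norm_image_sub_le_of_norm_hasDerivWithin_le (f := fun t => G u' t - t * b) (f' := fun t => Gv u' t - b)
      (s := uIcc v₀ (κ u')) (x := v₀) (y := κ u')
      (fun t _ => ((hGv u' t).sub ((hasDerivAt_id t).mul_const b)).hasDerivWithinAt.congr_deriv (by simp))
      (fun t ht => by rw [Real.norm_eq_abs]; exact hseg t ht) (convex_uIcc _ _) left_mem_uIcc right_mem_uIcc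
    rw [Real.norm_eq_abs, Real.norm_eq_abs] at key
    calc |G u' (κ u') - G u' v₀ - (κ u' - v₀) * b| = |(G u' (κ u') - κ u' * b) - (G u' v₀ - v₀ * b)| := by ring_nf
      _ ≤ ε₂ * |κ u' - v₀| := key
  -- the identity: both endpoints are zeros of `G`
  have hz1 : G u' (κ u') = 0 := hzero u' hu's
  have hz0 : G u v₀ = 0 := hzero u hu
  have hAB : (G u' v₀ - G u v₀ - (u' - u) * a) + (G u' (κ u') - G u' v₀ - (κ u' - v₀) * b) =
      -((u' - u) * a) - (κ u' - v₀) * b := by rw [hz1, hz0]; ring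
  have eq : κ u' - v₀ - (u' - u) * (-a / b) =
      -((G u' v₀ - G u v₀ - (u' - u) * a) + (G u' (κ u') - G u' v₀ - (κ u' - v₀) * b)) / b := by
    rw [hAB]; field_simp; ring
  rw [Real.norm_eq_abs, Real.norm_eq_abs, smul_eq_mul, show κ u = v₀ from rfl, eq, abs_div, abs_neg]
  rw [div_le_iff₀ hb0]
  calc |(G u' v₀ - G u v₀ - (u' - u) * a) + (G u' (κ u') - G u' v₀ - (κ u' - v₀) * b)|
      ≤ |G u' v₀ - G u v₀ - (u' - u) * a| + |G u' (κ u') - G u' v₀ - (κ u' - v₀) * b| := abs_add_le _ _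
    _ ≤ ε₁ * |u' - u| + ε₂ * |κ u' - v₀| := add_le_add hA hB
    _ ≤ ε₁ * |u' - u| + ε₂ * (C * |u' - u|) := by gcongr
    _ = (c * |b| / 2 + c * |b| / 2 * (C / (C + 1))) * |u' - u| := by rw [hε₁def, hε₂def]; field_simp
    _ ≤ (c * |b| / 2 + c * |b| / 2 * 1) * |u' - u| := by
        have : C / (C + 1) ≤ 1 := (div_le_one hC1).2 (by linarith)
        gcongr
    _ = c * |u' - u| * |b| := by ring

end ZeroCurve


/-! ## §2 A C¹ function on `[0,1]` (one-sided derivatives at the endpoints) extends to a C¹ function on `ℝ` -/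
section Extension

/-- **AFFINE C¹ EXTENSION OFF `[0,1]`**: if `κ₀` has derivative `κ₀′ u` WITHIN `[0,1]` at every `u ∈ [0,1]` and `κ₀′` is continuous on `[0,1]`, then the function
equal to `κ₀` on `[0,1]` and continued AFFINELY (slopes `κ₀′ 0`, `κ₀′ 1`) outside is C¹ on `ℝ` with derivative `κ₀′ ∘ proj_{[0,1]}`; the one-sided derivatives at
`0` and `1` are glued by `HasDerivWithinAt.union`. [folklore] -/
theorem exists_C1_extension {κ₀ κ₀' : ℝ → ℝ} (hd : ∀ u ∈ Icc (0 : ℝ) 1, HasDerivWithinAt κ₀ (κ₀' u) (Icc 0 1) u)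
    (hc : ContinuousOn κ₀' (Icc 0 1)) :
    ∃ κ κ' : ℝ → ℝ, (∀ u, HasDerivAt κ (κ' u) u) ∧ Continuous κ' ∧ ∀ u ∈ Icc (0 : ℝ) 1, κ u = κ₀ u := by
  let π : ℝ → ℝ := fun u => max 0 (min u 1)
  have hπm : ∀ u, π u ∈ Icc (0 : ℝ) 1 := fun u => ⟨le_max_left _ _, max_le zero_le_one (min_le_right _ _)⟩
  have hπc : Continuous π := continuous_const.max (continuous_id.min continuous_const)
  have hπid : ∀ u ∈ Icc (0 : ℝ) 1, π u = u := fun u hu => by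
    show max 0 (min u 1) = u
    rw [min_eq_left hu.2, max_eq_right hu.1]
  have hπneg : ∀ u : ℝ, u ≤ 0 → π u = 0 := fun u hu => by
    show max 0 (min u 1) = 0
    rw [min_eq_left (hu.trans zero_le_one), max_eq_left hu]
  have hπbig : ∀ u : ℝ, 1 ≤ u → π u = 1 := fun u hu => by
    show max 0 (min u 1) = 1
    rw [min_eq_right hu, max_eq_right zero_le_one]
  set κ : ℝ → ℝ := fun u => κ₀ (π u) + (u - π u) * κ₀' (π u) with hκ
  have hleft : ∀ u' : ℝ, u' ≤ 0 → κ u' = κ₀ 0 + (u' - 0) * κ₀' 0 := fun u' hu' => by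
    simp only [hκ, hπneg u' hu']
  have hright : ∀ u' : ℝ, 1 ≤ u' → κ u' = κ₀ 1 + (u' - 1) * κ₀' 1 := fun u' hu' => by
    simp only [hκ, hπbig u' hu']
  have hmid : ∀ u' ∈ Icc (0 : ℝ) 1, κ u' = κ₀ u' := fun u' hu' => by
    simp only [hκ, hπid u' hu', sub_self, zero_mul, add_zero]
  have haff : ∀ p k u : ℝ, HasDerivAt (fun u' => κ₀ p + (u' - p) * k) k u := fun p k u => by
    have h := (((hasDerivAt_id u).sub_const p).mul_const k).const_add (κ₀ p)
    simpa using h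
  refine ⟨κ, fun u => κ₀' (π u), fun u => ?_, hc.comp_continuous hπc hπm, hmid⟩
  show HasDerivAt κ (κ₀' (π u)) u
  rcases lt_trichotomy u 0 with hu0 | rfl | hu0
  · -- `u < 0`: the left affine piece
    rw [hπneg u hu0.le]
    refine (haff 0 (κ₀' 0) u).congr_of_eventuallyEq ?_
    filter_upwards [Iio_mem_nhds hu0] with u' hu' using hleft u' (le_of_lt hu')
  · -- `u = 0`: glue the left affine piece to `κ₀`
    rw [hπneg 0 le_rfl]
    have hL : HasDerivWithinAt κ (κ₀' 0) (Iic 0) 0 :=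
      (haff 0 (κ₀' 0) 0).hasDerivWithinAt.congr (fun u' hu' => hleft u' hu') (hleft 0 le_rfl)
    have hR : HasDerivWithinAt κ (κ₀' 0) (Ici 0) 0 := by
      have h := (hd 0 ⟨le_rfl, zero_le_one⟩).mono_of_mem_nhdsWithin (Icc_mem_nhdsGE zero_lt_one)
      refine h.congr_of_eventuallyEq ?_ (hmid 0 ⟨le_rfl, zero_le_one⟩)
      filter_upwards [Icc_mem_nhdsGE (zero_lt_one' ℝ)] with u' hu' using hmid u' hu'
    have h := hL.union hR
    rwa [Iic_union_Ici, hasDerivWithinAt_univ] at h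
  · rcases lt_trichotomy u 1 with hu1 | rfl | hu1
    · -- `0 < u < 1`: interior point, `κ = κ₀` nearby
      rw [hπid u ⟨hu0.le, hu1.le⟩]
      refine ((hd u ⟨hu0.le, hu1.le⟩).hasDerivAt (Icc_mem_nhds hu0 hu1)).congr_of_eventuallyEq ?_
      filter_upwards [Icc_mem_nhds hu0 hu1] with u' hu' using hmid u' hu'
    · -- `u = 1`: glue `κ₀` to the right affine piece
      rw [hπid 1 ⟨zero_le_one, le_rfl⟩]
      have hR : HasDerivWithinAt κ (κ₀' 1) (Ici 1) 1 :=
        (haff 1 (κ₀' 1) 1).hasDerivWithinAt.congr (fun u' hu' => hright u' hu') (hright 1 le_rfl)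
      have hL : HasDerivWithinAt κ (κ₀' 1) (Iic 1) 1 := by
        have h := (hd 1 ⟨zero_le_one, le_rfl⟩).mono_of_mem_nhdsWithin (Icc_mem_nhdsLE zero_lt_one)
        refine h.congr_of_eventuallyEq ?_ (hmid 1 ⟨zero_le_one, le_rfl⟩)
        filter_upwards [Icc_mem_nhdsLE (zero_lt_one' ℝ)] with u' hu' using hmid u' hu'
      have h := hL.union hR
      rwa [Iic_union_Ici, hasDerivWithinAt_univ] at h
    · -- `u > 1`: the right affine piece
      rw [hπbig u hu1.le]
      refine (haff 1 (κ₀' 1) u).congr_of_eventuallyEq ?_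
      filter_upwards [Ioi_mem_nhds hu1] with u' hu' using hright u' (le_of_lt hu')

end Extension

/-! ## §3 The monotone implicit-function lemma on the strip `[0,1] × [-V, V]` -/
section Strip

variable {G Gu Gv : ℝ → ℝ → ℝ} {γ V : ℝ}

/-- **THE MONOTONE IMPLICIT-FUNCTION LEMMA ON A STRIP** (the real-analysis half of K11c′).  `G : ℝ → ℝ → ℝ` with partial derivatives `∂_u G = Gu`, `∂_v G = Gv`
everywhere, both JOINTLY CONTINUOUS; on the strip `u ∈ [0,1]`, `v ∈ [-V, V]` (`V > 0`) the response is uniformly positive, `Gv ≥ γ > 0`, the window brackets the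
zero, `G(u,-V) ≤ 0 ≤ G(u,V)`, and both endpoints are already tuned, `G(0,0) = G(1,0) = 0`.  Then there is a C¹ function `κ : ℝ → ℝ` (derivative `κ′` continuous on
`ℝ`) with `κ 0 = κ 1 = 0`, values in `[-V, V]` on `[0,1]`, and `G(u, κ u) = 0` for `u ∈ [0,1]`.  Proof: pointwise IVT + strict monotonicity (§1) give the unique zero
curve `κ₀` on `[0,1]`; it is Lipschitz (`|Δκ₀| ≤ (sup|Gu|∕γ)·|Δu|` by the growth in `v` and the mean value inequality in `u`); `hasDerivWithinAt_of_implicit` gives its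
derivative `−Gu∕Gv` within `[0,1]`, continuous there; §2 extends it affinely to `ℝ`. [folklore] -/
theorem exists_C1_zeroCurve (hγ : 0 < γ) (hV : 0 < V)
    (hGu : ∀ u v, HasDerivAt (fun t => G t v) (Gu u v) u) (hGv : ∀ u v, HasDerivAt (fun t => G u t) (Gv u v) v)
    (hGu_c : Continuous (Function.uncurry Gu)) (hGv_c : Continuous (Function.uncurry Gv))
    (hresp : ∀ u ∈ Icc (0 : ℝ) 1, ∀ v ∈ Icc (-V) V, γ ≤ Gv u v)
    (hbr : ∀ u ∈ Icc (0 : ℝ) 1, G u (-V) ≤ 0 ∧ 0 ≤ G u V) (h0 : G 0 0 = 0) (h1 : G 1 0 = 0) :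
    ∃ κ κ' : ℝ → ℝ, (∀ u, HasDerivAt κ (κ' u) u) ∧ Continuous κ' ∧ κ 0 = 0 ∧ κ 1 = 0 ∧
      (∀ u ∈ Icc (0 : ℝ) 1, κ u ∈ Icc (-V) V) ∧ ∀ u ∈ Icc (0 : ℝ) 1, G u (κ u) = 0 := by
  -- the zero curve on `[0,1]`
  have hex : ∀ u : ℝ, ∃ v : ℝ, u ∈ Icc (0 : ℝ) 1 → v ∈ Icc (-V) V ∧ G u v = 0 := fun u => by
    by_cases hu : u ∈ Icc (0 : ℝ) 1
    · obtain ⟨v, hv, hv0⟩ := exists_zero_mem_Icc hV.le hGv (hbr u hu)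
      exact ⟨v, fun _ => ⟨hv, hv0⟩⟩
    · exact ⟨0, fun h => (hu h).elim⟩
  choose κ₀ hκ₀ using hex
  have hκ₀m : ∀ u ∈ Icc (0 : ℝ) 1, κ₀ u ∈ Icc (-V) V := fun u hu => (hκ₀ u hu).1
  have hκ₀z : ∀ u ∈ Icc (0 : ℝ) 1, G u (κ₀ u) = 0 := fun u hu => (hκ₀ u hu).2
  have h0V : (0 : ℝ) ∈ Icc (-V) V := ⟨by linarith, hV.le⟩
  have h0I : (0 : ℝ) ∈ Icc (0 : ℝ) 1 := ⟨le_rfl, zero_le_one⟩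
  have h1I : (1 : ℝ) ∈ Icc (0 : ℝ) 1 := ⟨zero_le_one, le_rfl⟩
  have hκ₀0 : κ₀ 0 = 0 := zero_unique_of_resp hγ hGv (hresp 0 h0I) (hκ₀m 0 h0I) h0V (hκ₀z 0 h0I) h0
  have hκ₀1 : κ₀ 1 = 0 := zero_unique_of_resp hγ hGv (hresp 1 h1I) (hκ₀m 1 h1I) h0V (hκ₀z 1 h1I) h1
  -- a bound on `|∂_u G|` over the strip
  obtain ⟨M, hM⟩ := (isCompact_Icc.prod isCompact_Icc : IsCompact (Icc (0 : ℝ) 1 ×ˢ Icc (-V) V)).exists_bound_of_continuousOn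
    hGu_c.continuousOn
  have hM0 : 0 ≤ M := (norm_nonneg _).trans (hM (0, 0) ⟨h0I, h0V⟩)
  -- the zero curve is Lipschitz on `[0,1]`
  have hlip : ∀ u ∈ Icc (0 : ℝ) 1, ∀ u' ∈ Icc (0 : ℝ) 1, |κ₀ u' - κ₀ u| ≤ M / γ * |u' - u| := by
    intro u hu u' hu'
    have hg := mul_abs_sub_le_abs_sub_of_resp hGv (hresp u' hu') (hκ₀m u hu) (hκ₀m u' hu')
    rw [hκ₀z u' hu', zero_sub, abs_neg] at hg
    have hmvt : |G u' (κ₀ u) - G u (κ₀ u)| ≤ M * |u' - u| := by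
      have key := Convex.norm_image_sub_le_of_norm_hasDerivWithin_le (f := fun t => G t (κ₀ u)) (f' := fun t => Gu t (κ₀ u))
        (s := Icc (0 : ℝ) 1) (x := u) (y := u') (fun t _ => (hGu t (κ₀ u)).hasDerivWithinAt)
        (fun t ht => hM (t, κ₀ u) ⟨ht, hκ₀m u hu⟩) (convex_Icc 0 1) hu hu'
      rwa [Real.norm_eq_abs, Real.norm_eq_abs] at key
    rw [hκ₀z u hu, sub_zero] at hmvt
    rw [div_mul_eq_mul_div, le_div_iff₀ hγ, mul_comm]
    exact hg.trans hmvt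
  -- its derivative within `[0,1]`, continuous there
  have hne : ∀ u ∈ Icc (0 : ℝ) 1, Gv u (κ₀ u) ≠ 0 := fun u hu => ne_of_gt (hγ.trans_le (hresp u hu _ (hκ₀m u hu)))
  have hder : ∀ u ∈ Icc (0 : ℝ) 1, HasDerivWithinAt κ₀ (-(Gu u (κ₀ u)) / Gv u (κ₀ u)) (Icc 0 1) u := fun u hu =>
    hasDerivWithinAt_of_implicit (hGu u (κ₀ u)) hGv hGv_c.continuousAt (hne u hu) hu hκ₀z (div_nonneg hM0 hγ.le)
      (fun u' hu' => hlip u hu u' hu')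
  have hκ₀c : ContinuousOn κ₀ (Icc 0 1) := fun u hu => (hder u hu).continuousWithinAt
  have hpair : ContinuousOn (fun u => (u, κ₀ u)) (Icc 0 1) := continuousOn_id.prodMk hκ₀c
  have hκ₀'c : ContinuousOn (fun u => -(Gu u (κ₀ u)) / Gv u (κ₀ u)) (Icc 0 1) :=
    (hGu_c.comp_continuousOn hpair).neg.div (hGv_c.comp_continuousOn hpair) hne
  -- extend to `ℝ`
  obtain ⟨κ, κ', hκd, hκ'c, hκeq⟩ := exists_C1_extension hder hκ₀'c
  refine ⟨κ, κ', hκd, hκ'c, by rw [hκeq 0 h0I, hκ₀0], by rw [hκeq 1 h1I, hκ₀1],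
    fun u hu => by rw [hκeq u hu]; exact hκ₀m u hu, fun u hu => by rw [hκeq u hu]; exact hκ₀z u hu⟩

end Strip

end YMDAG.N14.LawChannelTunedPath

end
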